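import Summits.CriticalPhenomena.PercolationContinuityZ3.Theorems.PercNearOneGluingNoHeavyPcintMeanMemFastUnits
import HarnessLib

/-!
# PCINT lane, reduced-state B3m certificates (bond), fast kernel format: the certificate theorem

Cell `prim-pcint` (PAPER-2 track (iii)), seat `prim-pcint-2` (gen 11); support file (`--supports stmt-CriticalPhenomena-4575`).
Does NOT build on p205010.  **`BondF.le_criticalProb_of_checkRowsF`**: if every row `i < N` of a fast-format table passes
`BondF.checkRowF τ kc … t i`, row `0` decodes to the empty state, the symmetry numbers denote lattice symmetries, the fourteen
arithmetic side conditions of `BondK.le_criticalProb_of_checkRowsM` hold and `3 ≤ B ≤ 31`, then `pn/D ≤ p_c^bond(ℤ^d)` — by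
`le_criticalProb_zd_of_meanMemTable` (`…PcintMeanMemSym`) applied to the denoted table, exactly as for the first kernel format
(`…PcintMeanMemKernelCert`), with the bridges of `…PcintMeanMemFastSound` / `…PcintMeanMemFastUnits`.
Memo: `run/shared/lean/prim/pcint/EFFICIENCY.md` §7.
-/

namespace Summit.CriticalPhenomena.PercolationContinuityZ3.Theorems.Pcint

open Finset Literature.Probability.Percolation Literature.Probability.LatticeModels

namespace BondF

open NawK (letters letterIdx mem_letters nodup_letters spermKL sum_letters_eq length_letters)

variable {d : ℕ}

/-! ### Soundness: checked rows bound `p_c^bond(ℤ^d)` from below -/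

section Sound

variable {B τ kc N nsym pn S T T3 M D lamN lamD : ℕ} {syms : List (List (ℕ × Bool))} {t : FT}

/-- `eqL` decides equality of coordinate lists. [folklore] -/
theorem eq_of_eqL : ∀ {v w : List ℕ}, eqL v w = true → v = w
  | [], [], _ => rfl
  | [], _ :: _, h => by simp [eqL] at h
  | _ :: _, [], h => by simp [eqL] at h
  | x :: v, y :: w, h => by
    simp only [eqL, Bool.and_eq_true] at h
    rw [Nat.eq_of_beq_eq_true h.1, eq_of_eqL h.2]

/-- `eqFS` decides equality of fast kernel states. [folklore] -/
theorem eq_of_eqFS : ∀ {L L' : FState}, eqFS L L' = true → L = L'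
  | [], [], _ => rfl
  | [], _ :: _, h => by simp [eqFS] at h
  | _ :: _, [], h => by simp [eqFS] at h
  | e :: L, e' :: L', h => by
    simp only [eqFS, Bool.and_eq_true] at h
    obtain ⟨⟨h2, h1⟩, h3⟩ := h
    rw [show e = e' from Prod.ext (eq_of_eqL h1) (Nat.eq_of_beq_eq_true h2), eq_of_eqFS h3]

/-- What a passed fast row check says. [folklore] -/
theorem checkRowF_spec {i : ℕ} (h : checkRowF d B τ kc N nsym pn S T M D lamN lamD syms t i = true) :
    ∃ v, t.find i = some v ∧ WFF d B (stateOf d B τ v.2.1) = true ∧ selfOK (locOf B kc (stateOf d B τ v.2.1)) = true ∧ 1 ≤ v.1 ∧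
      (∀ a, termOKF d B τ N syms t (stateOf d B τ v.2.1) a (decJ nsym (v.2.2.getD (letterIdx a) 0)) = true) ∧
      lamD * rowValF d B τ kc pn S T M D t (locOf B kc (stateOf d B τ v.2.1)) (stateOf d B τ v.2.1)
          (fun k => decJ nsym (v.2.2.getD k 0)) ≤ lamN * (2 * S ^ 2 * T ^ (2 * d - 1) * D ^ (6 * d + 3)) * v.1 := by
  unfold checkRowF at h
  cases hf : t.find i with
  | none => rw [hf] at h; exact Bool.noConfusion h
  | some v =>
    rw [hf] at h
    simp only [Bool.and_eq_true, decide_eq_true_eq, List.all_eq_true] at h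
    obtain ⟨⟨⟨⟨hwf, hself⟩, hv⟩, hall⟩, hineq⟩ := h
    exact ⟨v, rfl, hwf, hself, hv, fun a => hall a (mem_letters a), hineq⟩

/-- An accepted fast step starts with the site just left. [folklore] -/
theorem mstepF_eq_some {L T' : FState} {a : Fin d × Bool} (h : mstepF d B τ L a = some T') :
    ∃ rest, T' = (unitF d B (a.1, !a.2), 1) :: rest := by
  unfold mstepF at h
  split_ifs at h
  simp only [Option.some.injEq] at h
  exact ⟨_, h.symm⟩

/-- The empty symmetry table never matches an accepted step (so a matched symmetry number is in range). [folklore] -/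
theorem ne_actFS_nil [NeZero d] {L T' Lj : FState} {a : Fin d × Bool} (h : mstepF d B τ L a = some T') :
    T' ≠ actFS B [] Lj := by
  obtain ⟨rest, rfl⟩ := mstepF_eq_some h
  intro heq
  have hlen : (unitF d B (a.1, !a.2)).length = d := by simp [unitF, origF]
  cases Lj with
  | nil => simp [actFS] at heq
  | cons e Lj =>
    simp only [actFS, List.map_cons, List.cons.injEq, Prod.mk.injEq] at heq
    have : (unitF d B (a.1, !a.2)).length = 0 := by rw [heq.1.1]; simp [actF]
    rw [hlen] at this
    exact (NeZero.ne d) this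

set_option maxHeartbeats 800000 in
/-- **Soundness of the fast kernel certificate (bond, B3m).**  Same statement and proof architecture as
`BondK.le_criticalProb_of_checkRowsM`, with the fast kernel mirrors (`BondF.checkRowF`) and two format side conditions
(`3 ≤ B ≤ 31`).  (The assembly of some forty hypotheses exceeds the default heartbeat budget; no search tactic is involved.)
[folklore] -/
theorem le_criticalProb_of_checkRowsF [NeZero d] (hτ : kc + 4 ≤ τ) (hkc : 2 ≤ kc) (hB : 3 ≤ B) (hB' : B ≤ 31)
    (sym : ℕ → SPerm d) (hsyms : ∀ c < syms.length, syms.getD c [] = spermKL (sym c))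
    (hrows : ∀ i < N, checkRowF d B τ kc N nsym pn S T M D lamN lamD syms t i = true)
    (hN : 0 < N) (h0 : stOfF d B τ t 0 = []) (hD : 0 < D) (hpn : pn ≤ D) (hS1 : S ≤ D) (hT0 : 0 < T) (hTT3 : T ≤ T3)
    (hT3S : T3 ≤ S) (hM2 : T + T3 ≤ 2 * M) (hMS : M ≤ S)
    (hSS : D ^ 2 ≤ S ^ 2 + pn ^ 2) (htp : (D - pn) * (D + 2 * pn) ≤ T * (D + pn)) (hgap : pn ^ 2 ≤ (T3 - T) * (D + pn))
    (hqt : (D - pn) * D ^ 2 ≤ S * T ^ 2) (hts2 : T * D ≤ S ^ 2) (hlam : lamN < lamD) :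
    (pn : ℝ) / D ≤ criticalProb (zdGraph d) 0 := by
  classical
  have hB1 : 1 ≤ B := by omega
  have hDr : (0 : ℝ) < D := Nat.cast_pos.2 hD
  have hTr : (0 : ℝ) < T := Nat.cast_pos.2 hT0
  have hTS : T ≤ S := hTT3.trans hT3S
  have hS0 : 0 < S := lt_of_lt_of_le hT0 hTS
  have hSr : (0 : ℝ) < S := Nat.cast_pos.2 hS0
  have hlamDr : (0 : ℝ) < lamD := Nat.cast_pos.2 (by omega)
  -- the constants
  set p : unitInterval := ⟨(pn : ℝ) / D, div_nonneg (Nat.cast_nonneg _) hDr.le,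
    div_le_one_of_le₀ (by exact_mod_cast hpn) hDr.le⟩ with hp
  set s : ℝ := (S : ℝ) / D with hs
  set tv : ℝ := (T : ℝ) / D with htv
  set t' : ℝ := (T3 : ℝ) / D with ht'
  set mv : ℝ := (M : ℝ) / D with hmvdef
  set κb : ℝ := ((D : ℝ) * D + (S : ℝ) * S) / (2 * (D : ℝ) ^ 2) with hκb
  set lam : ℝ := (lamN : ℝ) / lamD with hlamdef
  have hpc : (p : ℝ) = (pn : ℝ) / D := rfl
  have hsub : (((D - pn : ℕ) : ℝ)) = (D : ℝ) - pn := Nat.cast_sub hpn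
  have hsub3 : (((T3 - T : ℕ) : ℝ)) = (T3 : ℝ) - T := Nat.cast_sub hTT3
  have hq1 : 1 - (p : ℝ) = (((D - pn : ℕ) : ℝ)) / D := by rw [hsub, hpc]; field_simp
  have hs0' : 0 < s := div_pos hSr hDr
  have hs1' : s ≤ 1 := div_le_one_of_le₀ (by exact_mod_cast hS1) hDr.le
  have ht0' : 0 < tv := div_pos hTr hDr
  have hts' : tv ≤ s := div_le_div_of_nonneg_right (by exact_mod_cast hTS) hDr.le
  have htt' : tv ≤ t' := div_le_div_of_nonneg_right (by exact_mod_cast hTT3) hDr.le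
  have ht's : t' ≤ s := div_le_div_of_nonneg_right (by exact_mod_cast hT3S) hDr.le
  have hmv' : (tv + t') / 2 ≤ mv := by
    have key : ((T : ℝ) + T3) ≤ 2 * M := by exact_mod_cast hM2
    have e : (tv + t') / 2 = ((T : ℝ) + T3) / (2 * D) := by rw [htv, ht']; ring
    rw [e, hmvdef, div_le_div_iff₀ (by positivity) hDr]
    have := mul_le_mul_of_nonneg_right key hDr.le
    linarith [this]
  have hms' : mv ≤ s := div_le_div_of_nonneg_right (by exact_mod_cast hMS) hDr.le
  have htm' : tv ≤ mv := (show tv ≤ (tv + t') / 2 by linarith).trans hmv'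
  have hm0' : 0 ≤ mv := ht0'.le.trans htm'
  have hSr1 : (S : ℝ) ≤ D := by exact_mod_cast hS1
  have hκ : (1 + s ^ 2) / 2 ≤ κb := by rw [hκb, hs]; apply le_of_eq; field_simp
  have hκb1 : κb ≤ 1 := by
    rw [hκb, div_le_one (by positivity)]
    have : (S : ℝ) * S ≤ (D : ℝ) * D := mul_le_mul hSr1 hSr1 (Nat.cast_nonneg _) hDr.le
    nlinarith [this]
  have hκb0 : 0 ≤ κb := by rw [hκb]; positivity
  have hlam0 : 0 ≤ lam := div_nonneg (Nat.cast_nonneg _) hlamDr.le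
  have hlam1 : lam < 1 := (div_lt_one hlamDr).2 (by exact_mod_cast hlam)
  have hps : 1 - (p : ℝ) ^ 2 ≤ s ^ 2 := by
    have key : (D : ℝ) ^ 2 ≤ (S : ℝ) ^ 2 + (pn : ℝ) ^ 2 := by exact_mod_cast hSS
    rw [hpc, hs, div_pow, div_pow, sub_le_iff_le_add, ← add_div, le_div_iff₀ (by positivity), one_mul]
    exact key
  have htp' : (1 - (p : ℝ)) * (1 + 2 * p) ≤ tv * (1 + p) := by
    have key : ((D : ℝ) - pn) * (D + 2 * pn) ≤ (T : ℝ) * (D + pn) := by rw [← hsub]; exact_mod_cast htp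
    rw [hpc, htv]
    rw [show (1 - (pn : ℝ) / D) * (1 + 2 * ((pn : ℝ) / D)) = ((D : ℝ) - pn) * (D + 2 * pn) / ((D : ℝ) * D) by
      field_simp, show (T : ℝ) / D * (1 + (pn : ℝ) / D) = (T : ℝ) * (D + pn) / ((D : ℝ) * D) by field_simp]
    exact div_le_div_of_nonneg_right key (by positivity)
  have hgap' : (p : ℝ) ^ 2 ≤ (t' - tv) * (1 + p) := by
    have key : (pn : ℝ) ^ 2 ≤ ((T3 : ℝ) - T) * ((D : ℝ) + pn) := by rw [← hsub3]; exact_mod_cast hgap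
    rw [hpc, ht', htv]
    rw [show ((pn : ℝ) / D) ^ 2 = (pn : ℝ) ^ 2 / ((D : ℝ) * D) by field_simp,
      show ((T3 : ℝ) / D - (T : ℝ) / D) * (1 + (pn : ℝ) / D) = ((T3 : ℝ) - T) * ((D : ℝ) + pn) / ((D : ℝ) * D) by field_simp]
    exact div_le_div_of_nonneg_right key (by positivity)
  have hqt' : 1 - (p : ℝ) ≤ s * tv ^ 2 := by
    have key : ((D : ℝ) - pn) * (D : ℝ) ^ 2 ≤ (S : ℝ) * (T : ℝ) ^ 2 := by rw [← hsub]; exact_mod_cast hqt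
    rw [hpc, hs, htv]
    rw [show (1 - (pn : ℝ) / D) = ((D : ℝ) - pn) * (D : ℝ) ^ 2 / (D : ℝ) ^ 3 by field_simp,
      show (S : ℝ) / D * ((T : ℝ) / D) ^ 2 = (S : ℝ) * (T : ℝ) ^ 2 / (D : ℝ) ^ 3 by field_simp]
    exact div_le_div_of_nonneg_right key (by positivity)
  have hts2' : tv ≤ s ^ 2 := by
    have key : (T : ℝ) * D ≤ (S : ℝ) ^ 2 := by exact_mod_cast hts2
    rw [hs, htv, div_pow, div_le_div_iff₀ hDr (by positivity)]
    nlinarith [key]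
  have hq0 : 0 ≤ 1 - (p : ℝ) := sub_nonneg.2 p.2.2
  have hq_t : 1 - (p : ℝ) ≤ tv := by
    have ht1 : tv ≤ 1 := hts'.trans hs1'
    calc 1 - (p : ℝ) ≤ s * tv ^ 2 := hqt'
      _ ≤ 1 * tv ^ 2 := mul_le_mul_of_nonneg_right hs1' (sq_nonneg _)
      _ = tv * tv := by ring
      _ ≤ tv * 1 := mul_le_mul_of_nonneg_left ht1 ht0'.le
      _ = tv := mul_one _
  have hq_s2 : 1 - (p : ℝ) ≤ s ^ 2 := hq_t.trans hts2'
  -- the semantic table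
  let Rw : Fin N → MState d := fun i => toMF B (stOfF d B τ t i)
  let V : Fin N → ℝ := fun i => (vOfF t i : ℝ)
  let sc : Fin N → Fin d × Bool → Option (Fin N × SPerm d) := fun i a =>
    match scOfF nsym t i (letterIdx a) with
    | none => none
    | some jc => if h : jc.1 < N then some ((⟨jc.1, h⟩ : Fin N), sym jc.2) else none
  have hrow : ∀ i : Fin N, ∃ v, t.find i = some v ∧ WFF d B (stateOf d B τ v.2.1) = true ∧
      selfOK (locOf B kc (stateOf d B τ v.2.1)) = true ∧ 1 ≤ v.1 ∧
      (∀ a, termOKF d B τ N syms t (stateOf d B τ v.2.1) a (decJ nsym (v.2.2.getD (letterIdx a) 0)) = true) ∧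
      lamD * rowValF d B τ kc pn S T M D t (locOf B kc (stateOf d B τ v.2.1)) (stateOf d B τ v.2.1)
          (fun k => decJ nsym (v.2.2.getD k 0)) ≤ lamN * (2 * S ^ 2 * T ^ (2 * d - 1) * D ^ (6 * d + 3)) * v.1 :=
    fun i => checkRowF_spec (hrows i i.2)
  have hst : ∀ (i : ℕ) v, t.find i = some v → stOfF d B τ t i = stateOf d B τ v.2.1 := fun i v h => by simp [stOfF, h]
  have hv : ∀ (i : ℕ) v, t.find i = some v → vOfF t i = v.1 := fun i v h => by simp [vOfF, h]
  have hsc : ∀ (i : ℕ) v, t.find i = some v → ∀ k, scOfF nsym t i k = decJ nsym (v.2.2.getD k 0) := fun i v h k => by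
    simp [scOfF, h]
  have hWF : ∀ j : Fin N, WFF d B (stOfF d B τ t j) = true := fun j => by
    obtain ⟨v, hf, hwf, -⟩ := hrow j; rw [hst j v hf]; exact hwf
  have hV : ∀ i, 1 ≤ V i := fun i => by
    obtain ⟨v, hf, -, -, hv1, -⟩ := hrow i
    show (1 : ℝ) ≤ (vOfF t i : ℝ)
    rw [hv i v hf]; exact_mod_cast hv1
  have h0' : Rw ⟨0, hN⟩ = ∅ := by
    show toMF B (stOfF d B τ t 0) = (∅ : MState d)
    rw [h0]; rfl
  -- simulation
  have hsim : ∀ i a, simRel Rw (mstep τ (Rw i) a) (sc i a) = true := by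
    intro i a
    obtain ⟨v, hf, hwf, hself, -, hok, -⟩ := hrow i
    have hRi : Rw i = toMF B (stateOf d B τ v.2.1) := by show toMF B (stOfF d B τ t i) = _; rw [hst i v hf]
    have hoka := hok a
    unfold termOKF at hoka
    have hsci : sc i a = (match decJ nsym (v.2.2.getD (letterIdx a) 0) with
        | none => none
        | some jc => if h : jc.1 < N then some ((⟨jc.1, h⟩ : Fin N), sym jc.2) else none) := by
      show (match scOfF nsym t i (letterIdx a) with
        | none => none
        | some jc => if h : jc.1 < N then some ((⟨jc.1, h⟩ : Fin N), sym jc.2) else none) = _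
      rw [hsc i v hf]
    rw [hRi, mstep_toMF hwf hB1, hsci]
    cases hT : mstepF d B τ (stateOf d B τ v.2.1) a with
    | none =>
      rw [hT] at hoka
      cases hos : decJ nsym (v.2.2.getD (letterIdx a) 0) with
      | none => rfl
      | some jc => rw [hos] at hoka; exact Bool.noConfusion hoka
    | some T' =>
      rw [hT] at hoka
      cases hos : decJ nsym (v.2.2.getD (letterIdx a) 0) with
      | none => rw [hos] at hoka; exact Bool.noConfusion hoka
      | some jc =>
        rw [hos] at hoka
        rcases jc with ⟨j, c⟩
        simp only [Bool.and_eq_true, decide_eq_true_eq] at hoka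
        obtain ⟨hjN, hseq'⟩ := hoka
        have hseq := eq_of_eqFS hseq'
        have hc : c < syms.length := by
          by_contra hc
          rw [List.getD_eq_getElem?_getD, List.getElem?_eq_none (not_lt.1 hc), Option.getD_none] at hseq
          exact ne_actFS_nil hT hseq
        simp only [Option.map_some, dif_pos hjN, simRel, decide_eq_true_eq]
        rw [hseq, hsyms c hc, toMF_actFS]
        intro e he
        have hj := WFF_spec (hWF ⟨j, hjN⟩) e he
        exact ⟨hj.1, fun x hx => by have := (hj.2.2 x hx).2; omega⟩
  -- Collatz–Wielandt rows
  set DEN : ℝ := 2 * (S : ℝ) ^ 2 * (T : ℝ) ^ (2 * d - 1) * (D : ℝ) ^ (6 * d + 3) with hDEN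
  have hDEN0 : 0 < DEN := by positivity
  have hcw : ∀ i, (∑ a : Fin d × Bool, match sc i a with
      | none => 0
      | some jg => (p : ℝ) * bmwt (1 - p) s tv mv κb τ kc (Rw i) a * V jg.1) ≤ lam * V i := by
    intro i
    obtain ⟨v, hf, hwf, hself, hv1, hok, hineq⟩ := hrow i
    set L := stateOf d B τ v.2.1 with hL
    have hRi : Rw i = toMF B L := by show toMF B (stOfF d B τ t i) = _; rw [hst i v hf]
    have hterm : ∀ a, (match sc i a with
        | none => 0
        | some jg => (p : ℝ) * bmwt (1 - p) s tv mv κb τ kc (Rw i) a * V jg.1) ≤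
        (termValF d B τ kc pn S T M D t (locOf B kc L) L a (decJ nsym (v.2.2.getD (letterIdx a) 0)) : ℝ) / DEN := by
      intro a
      have hoka := hok a
      unfold termOKF at hoka
      have hsci : sc i a = (match decJ nsym (v.2.2.getD (letterIdx a) 0) with
          | none => none
          | some jc => if h : jc.1 < N then some ((⟨jc.1, h⟩ : Fin N), sym jc.2) else none) := by
        show (match scOfF nsym t i (letterIdx a) with
          | none => none
          | some jc => if h : jc.1 < N then some ((⟨jc.1, h⟩ : Fin N), sym jc.2) else none) = _
        rw [hsc i v hf]
      rw [hsci]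
      cases hos : decJ nsym (v.2.2.getD (letterIdx a) 0) with
      | none => simp only [termValF, Nat.cast_zero, zero_div, le_refl]
      | some jc =>
        rw [hos] at hoka
        cases hT : mstepF d B τ L a with
        | none => rw [hT] at hoka; exact Bool.noConfusion hoka
        | some T' =>
          rw [hT] at hoka
          rcases jc with ⟨j, c⟩
          simp only [Bool.and_eq_true, decide_eq_true_eq] at hoka
          obtain ⟨hjN, -⟩ := hoka
          simp only [dif_pos hjN, termValF]
          obtain ⟨huK, hutK, humK, hcK⟩ := counts_le (B := B) (τ := τ) (kc := kc) (locOf B kc L) a (d := d)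
          rw [hDEN, BondK.termValM_real_eq (pn := pn) (CF := BondK.CFnum d pn S T D (chordF d B (locOf B kc L) a))
            (us := cdetF d B τ kc (locOf B kc L) a - utF d B (locOf B kc L) a - umF d B (locOf B kc L) a) (ut := utF d B (locOf B kc L) a) (um := umF d B (locOf B kc L) a)
            (F := if cornerF d B (locOf B kc L) L a then D * D + S * S else 2 * (D * D)) (Vj := vOfF t j) (by omega) hDr hSr hTr,
            BondK.CFnum_real_eq hcK hSr hTr hDr, ← hq1]
          have hVj : V ⟨j, hjN⟩ = (vOfF t j : ℝ) := rfl
          rw [hVj, hRi]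
          -- compare factor by factor
          have hc := chordF_le_bchord hwf hB hB' a (d := d) (kc := kc)
          have hu := cdetF_le_cdet hwf hself hB hB' a (d := d) (τ := τ) (kc := kc)
          have hut := utF_le_ctu hwf hself hB hB' a (d := d)
          have hum := umF_le_cmu hwf hB hB' a (d := d) (kc := kc)
          have hctu := ctu_add_cmu_le τ kc (toMF B L : MState d) a
          have hchord : tchordF (1 - (p : ℝ)) s tv (bchord (toMF B L : MState d) a) ≤
              tchordF (1 - (p : ℝ)) s tv (chordF d B (locOf B kc L) a) := tchordF_anti hq0 hq_t hq_s2 hs0' ht0' hc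
          have hunits : s ^ (cdet τ kc (toMF B L : MState d) a - ctu kc (toMF B L : MState d) a - cmu kc (toMF B L : MState d) a) *
              tv ^ ctu kc (toMF B L : MState d) a * mv ^ cmu kc (toMF B L : MState d) a ≤
              s ^ (cdetF d B τ kc (locOf B kc L) a - utF d B (locOf B kc L) a - umF d B (locOf B kc L) a) * tv ^ utF d B (locOf B kc L) a * mv ^ umF d B (locOf B kc L) a :=
            ChainBond.pow3_mono hs1' ht0'.le htm' hms' hut hum (by omega)
          have hcf : (if bcorner (toMF B L : MState d) a then κb else 1) ≤
              (((if cornerF d B (locOf B kc L) L a then D * D + S * S else 2 * (D * D) : ℕ) : ℝ) / (2 * (D : ℝ) ^ 2)) := by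
            by_cases hcK : cornerF d B (locOf B kc L) L a = true
            · rw [if_pos (bcorner_of_cornerF hwf hcK), if_pos hcK, hκb]; push_cast; exact le_of_eq (by ring)
            · rw [if_neg hcK]
              have e2 : (((2 * (D * D) : ℕ) : ℝ)) / (2 * (D : ℝ) ^ 2) = 1 := by push_cast; field_simp
              rw [e2]
              split_ifs
              · exact hκb1
              · exact le_rfl
          have hp0 : (0 : ℝ) ≤ (pn : ℝ) / D := div_nonneg (Nat.cast_nonneg _) hDr.le
          have hchord0 : 0 ≤ tchordF (1 - (p : ℝ)) s tv (bchord (toMF B L : MState d) a) := tchordF_nonneg hq0 hs0'.le ht0'.le _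
          have hchordK0 : 0 ≤ tchordF (1 - (p : ℝ)) s tv (chordF d B (locOf B kc L) a) := tchordF_nonneg hq0 hs0'.le ht0'.le _
          have hunits0 : 0 ≤ s ^ (cdet τ kc (toMF B L : MState d) a - ctu kc (toMF B L : MState d) a -
              cmu kc (toMF B L : MState d) a) * tv ^ ctu kc (toMF B L : MState d) a * mv ^ cmu kc (toMF B L : MState d) a := by
            positivity
          have hcor0 : (0 : ℝ) ≤ (if bcorner (toMF B L : MState d) a then κb else 1) := by
            split_ifs; exact hκb0; exact zero_le_one
          have hF0 : (0 : ℝ) ≤ (((if cornerF d B (locOf B kc L) L a then D * D + S * S else 2 * (D * D) : ℕ) : ℝ) / (2 * (D : ℝ) ^ 2)) := by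
            positivity
          show (pn : ℝ) / D * (tchordF (1 - (p : ℝ)) s tv (bchord (toMF B L : MState d) a) *
              (s ^ (cdet τ kc (toMF B L : MState d) a - ctu kc (toMF B L : MState d) a - cmu kc (toMF B L : MState d) a) *
                tv ^ ctu kc (toMF B L : MState d) a * mv ^ cmu kc (toMF B L : MState d) a *
                (if bcorner (toMF B L : MState d) a then κb else 1))) * (vOfF t j : ℝ) ≤ _
          calc (pn : ℝ) / D * (tchordF (1 - (p : ℝ)) s tv (bchord (toMF B L : MState d) a) *
                (s ^ (cdet τ kc (toMF B L : MState d) a - ctu kc (toMF B L : MState d) a - cmu kc (toMF B L : MState d) a) *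
                  tv ^ ctu kc (toMF B L : MState d) a * mv ^ cmu kc (toMF B L : MState d) a *
                  (if bcorner (toMF B L : MState d) a then κb else 1))) * (vOfF t j : ℝ)
              ≤ (pn : ℝ) / D * (tchordF (1 - (p : ℝ)) s tv (chordF d B (locOf B kc L) a) *
                  (s ^ (cdetF d B τ kc (locOf B kc L) a - utF d B (locOf B kc L) a - umF d B (locOf B kc L) a) * tv ^ utF d B (locOf B kc L) a * mv ^ umF d B (locOf B kc L) a *
                    ((((if cornerF d B (locOf B kc L) L a then D * D + S * S else 2 * (D * D) : ℕ) : ℝ) / (2 * (D : ℝ) ^ 2))))) *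
                  (vOfF t j : ℝ) := by
                refine mul_le_mul_of_nonneg_right (mul_le_mul_of_nonneg_left (mul_le_mul hchord
                  (mul_le_mul hunits hcf hcor0 (by positivity)) (mul_nonneg hunits0 hcor0) hchordK0) hp0) (Nat.cast_nonneg _)
            _ = _ := by ring
    calc (∑ a : Fin d × Bool, match sc i a with
            | none => 0
            | some jg => (p : ℝ) * bmwt (1 - p) s tv mv κb τ kc (Rw i) a * V jg.1)
        ≤ ∑ a : Fin d × Bool, (termValF d B τ kc pn S T M D t (locOf B kc L) L a (decJ nsym (v.2.2.getD (letterIdx a) 0)) : ℝ) /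
            DEN := Finset.sum_le_sum fun a _ => hterm a
      _ = (rowValF d B τ kc pn S T M D t (locOf B kc L) L (fun k => decJ nsym (v.2.2.getD k 0)) : ℝ) / DEN := by
          rw [← Finset.sum_div, rowValF, ← sum_letters_eq, Nat.cast_list_sum, List.map_map]; rfl
      _ ≤ lam * V i := by
          rw [div_le_iff₀ hDEN0, hlamdef]
          show _ ≤ (lamN : ℝ) / lamD * (vOfF t i : ℝ) * DEN
          rw [hv i v hf, div_mul_eq_mul_div, div_mul_eq_mul_div, le_div_iff₀ hlamDr]
          calc (rowValF d B τ kc pn S T M D t (locOf B kc L) L (fun k => decJ nsym (v.2.2.getD k 0)) : ℝ) * lamD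
              = ((lamD * rowValF d B τ kc pn S T M D t (locOf B kc L) L (fun k => decJ nsym (v.2.2.getD k 0)) : ℕ) : ℝ) := by
                push_cast; ring
            _ ≤ ((lamN * (2 * S ^ 2 * T ^ (2 * d - 1) * D ^ (6 * d + 3)) * v.1 : ℕ) : ℝ) := by exact_mod_cast hineq
            _ = (lamN : ℝ) * (v.1 : ℝ) * DEN := by rw [hDEN]; push_cast; ring
  have main := le_criticalProb_zd_of_meanMemTable (d := d) hτ hkc p hps hs0' hs1' ht0' htt' ht's hmv' hms' htp' hgap' hqt' hts2'
    hκ hlam0 hlam1 Rw sc V ⟨0, hN⟩ h0' hV hsim hcw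
  exact main

end Sound

end BondF

end Summit.CriticalPhenomena.PercolationContinuityZ3.Theorems.Pcint
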